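import Literature.Computability.AlgebraicComplexity.DDS21GenClass
import Literature.Computability.AlgebraicComplexity.UABPToolkit
import Literature.Computability.AlgebraicComplexity.DDS21DeborderReadOnce
import Literature.Computability.AlgebraicComplexity.DDS21BloatedRatioDeborder
import HarnessLib

/-!
# Dutta–Dwivedi–Saxena 2021, Claim 3.3 (`\overline{Gen(1, s)} ⊆ ABP/ABP`) and Claim 3.8's limit step,
# in the tree's ABP currency

Topic `Literature/Computability/AlgebraicComplexity`; cell `val-lit`, row X2-DDS21, brick **B3**, part 2 (companion
of `DDS21GenClass.lean`, lead-np RULING (128)); a PROOFS file: theorems only, no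
definitions, no named facts. Source: P. Dutta, P. Dwivedi, N. Saxena, *Demystifying the border of depth-3 algebraic
circuits*, FOCS 2021 [DuttaDwivediSaxena2022], held full version `paper:galaxy-pdf-7641649743695546420`.

* **Claim 3.3, the ABP side** (p0027 L724–744: "`\overline{Gen(1,s)} ⊆ ABP/ABP`, of size
  `O(s d⁴ n)`"), [CharZero F]: t19 g11's `ε → 0` step `DDS2021.deborder_gen_one` (file
  `DDS21BloatedRatioDeborder.lean`: the limit of a `Gen(1)` element `(U/V)(P/Q)` over `F(ε)` equal
  to an `ε`-integral fraction `M/E` is `u·(U₀P₀)/(V₀Q₀)` with `U₀, V₀ ∈ ΠΣ`, `P₀, Q₀ ∈ \overline{Σ∧Σ}`)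
  glued BY NAME with the tree's `ΠΣ ⊆ ABP` (`uabpComputes_of_mem_spsClass`, `UABPToolkit.lean`,
  t18) and `\overline{Σ∧Σ} ⊆ ARO ⊆ ABP` (`uabpComputes_of_mem_border_swsClass`,
  `DDS21DeborderReadOnce.lean`, t24 — Lemma 2.23) and `UABPComputes.mul`: the limit is `u·A/B` with
  `A, B` computed by univariate-labelled layered ABPs of the explicit budget
  `(1·(2 + d((n+1)2+2)) + 2) + ((n+1)(t((n+1)e+1)) + e + 2)` (the `ΠΣ ⊆ ABP` budget at `k = 1` plus
  the `\overline{Σ∧Σ} ⊆ ABP` budget; print: "`O(s d⁴ n)`"),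
  `B ≠ 0` (`uabp_of_deborder_gen_one`; printed target `f = f₁/f₂`: `uabp_of_deborder_gen_one_ratio`,
  "`f ∈ ABP/ABP`" in cleared form `f₁·B = A·f₂`). For a `GenTerm T` of `DDS21GenClass.lean` the
  data form is the one-liner `uabp_of_deborder_gen_one T.U_mem T.V_mem T.P_mem T.Q_mem T.V_ne_zero
  T.Q_ne_zero` (with `T.num = T.U * T.P`, `T.den = T.V * T.Q` by `rfl`); it is not restated here so
  that this file does not import the (review-lane) data file.
* **Claim 3.8's limit step** `lim (Σ∧Σ/Σ∧Σ) ⊆ ABP/ABP` in the same currency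
  (`uabp_of_border_div_swsClass`, from t19 g11's `border_div_swsClass`; the `z = 0` values of the
  trace-back, brick B5, export (E_j.2) of HOME/np/MEMO-t18g10-DDS21-B5-traceback.md).

What this is NOT: the DiDIL step (Claims 3.4–3.6, brick B4) and the trace-back (Claims 3.7–3.8, B5) are
not addressed; `DDS2021_thm_3_2` / `_5_1` stay named facts. Honest framing: bookkeeping toward a
published 2021 upper bound; nothing here bears on VP versus VNP, which is NOT proved.

## References

* [DuttaDwivediSaxena2022] P. Dutta, P. Dwivedi, N. Saxena, *Demystifying the border of depth-3
  algebraic circuits*, Proc. 62nd FOCS (2021), IEEE 2022, 92–103; full version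
  `paper:galaxy-pdf-7641649743695546420`: Def. 3.1 p0026 L702–708, Claim 3.3 p0027 L724–744,
  Claim 3.8 p0036 L938–943, Lemma 2.23 p0025 L661–664.
-/

noncomputable section

open MvPolynomial
open scoped BigOperators Polynomial

namespace Literature.Computability.AlgebraicComplexity

namespace DDS2021

/-! ### §3 Claim 3.3, the ABP side: `\overline{Gen(1, s)} ⊆ ABP/ABP` with an explicit budget -/

section ClaimThreeThree

variable {F : Type*} [Field F] {n : ℕ}

variable [CharZero F]

/-- **DDS Claim 3.3, ABP side** ("`\overline{Gen(1,s)} ⊆ ABP/ABP`, of size `O(s d⁴ n)`", p0027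
L724–744). If a `Gen(1, ·)` element `(U/V)·(P/Q)` over `F(ε)` (`U, V ∈ ΠΣ`, `P, Q ∈ Σ∧Σ`, `V Q ≠ 0`)
equals an `ε`-integral fraction `M/E` with `E(0) ≠ 0` (cleared: `U P · ι E = ι M · V Q`), then its
limit `M(0)/E(0)` is `u · A/B` with `A, B` computed by univariate-labelled layered ABPs within the budget of the `ΠΣ` and `\overline{Σ∧Σ}` conversions
and `B ≠ 0`: `M(0) · B = u · A · E(0)`, `u ≠ 0` unless `M(0) = 0`. The
`ε → 0` step is t19 g11's `deborder_gen_one` ("`f = (lim Ũ/lim Ṽ)·(lim P̃/lim Q̃) ∈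
(ΠΣ/ΠΣ)·(ARO/ARO)`"); the conversion is `ΠΣ ⊆ ABP` (`uabpComputes_of_mem_spsClass`) and Lemma 2.23
`\overline{Σ∧Σ} ⊆ ABP` (`uabpComputes_of_mem_border_swsClass`), multiplied by `UABPComputes.mul`.
[cite: DuttaDwivediSaxena2022, Claim 3.3 with proof (full version p0027 L724–744)] -/
theorem uabp_of_deborder_gen_one {d t e : ℕ} {U V P Q : MvPolynomial (Fin n) (RatFunc F)}
    (hU : U ∈ spsClass (RatFunc F) n 1 d) (hV : V ∈ spsClass (RatFunc F) n 1 d)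
    (hP : P ∈ swsClass (RatFunc F) n t e) (hQ : Q ∈ swsClass (RatFunc F) n t e)
    (hV0 : V ≠ 0) (hQ0 : Q ≠ 0) {E M : MvPolynomial (Fin n) F[X]}
    (hE : map (Polynomial.constantCoeff : F[X] →+* F) E ≠ 0)
    (heq : U * P * map (algebraMap F[X] (RatFunc F)) E =
      map (algebraMap F[X] (RatFunc F)) M * (V * Q)) :
    ∃ A B : MvPolynomial (Fin n) F,
      UABPComputes ((1 * (2 + d * ((n + 1) * 2 + 2)) + 2) + ((n + 1) * (t * ((n + 1) * e + 1)) + e + 2)) A ∧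
      UABPComputes ((1 * (2 + d * ((n + 1) * 2 + 2)) + 2) + ((n + 1) * (t * ((n + 1) * e + 1)) + e + 2)) B ∧ B ≠ 0 ∧
      ∃ u : F, map (Polynomial.constantCoeff : F[X] →+* F) M * B =
          C u * A * map (Polynomial.constantCoeff : F[X] →+* F) E ∧
        (map (Polynomial.constantCoeff : F[X] →+* F) M ≠ 0 → u ≠ 0) := by
  obtain ⟨U₀, V₀, P₀, Q₀, hU₀, hV₀, hP₀, hQ₀, hV₀0, hQ₀0, u, hu, hu0⟩ :=
    deborder_gen_one hU hV hP hQ hV0 hQ0 hE heq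
  refine ⟨U₀ * P₀, V₀ * Q₀, ?_, ?_, mul_ne_zero hV₀0 hQ₀0, u, hu, hu0⟩
  · exact (uabpComputes_of_mem_spsClass hU₀).mul (uabpComputes_of_mem_border_swsClass hP₀)
  · exact (uabpComputes_of_mem_spsClass hV₀).mul (uabpComputes_of_mem_border_swsClass hQ₀)

/-- **Claim 3.3 with the printed target "`g = (U/V)·(P/Q) = f + ε·S`, `f = f₁/f₂ ∈ ABP/ABP`"**, in
cleared form: if `U P · f₂ D = (f₁ D + ε S f₂) · V Q` (`D(0) ≠ 0`, `f₂ ≠ 0`), then `f₁ · B = A · f₂`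
with `A, B` computed by univariate-labelled layered ABPs (the same budgets, `+ 2` for
the absorbed scalar) and `B ≠ 0` — i.e. `f = A/B ∈ ABP/ABP`. (From t19 g11's
`deborder_gen_one_ratio`; the unit `u` is absorbed into `A` by `UABPComputes.smul_C`.)
[cite: DuttaDwivediSaxena2022, Claim 3.3 with proof (full version p0027 L724–744)] -/
theorem uabp_of_deborder_gen_one_ratio {d t e : ℕ} {U V P Q : MvPolynomial (Fin n) (RatFunc F)}
    (hU : U ∈ spsClass (RatFunc F) n 1 d) (hV : V ∈ spsClass (RatFunc F) n 1 d)
    (hP : P ∈ swsClass (RatFunc F) n t e) (hQ : Q ∈ swsClass (RatFunc F) n t e)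
    (hV0 : V ≠ 0) (hQ0 : Q ≠ 0) {f₁ f₂ : MvPolynomial (Fin n) F} (hf₂ : f₂ ≠ 0)
    {S D : MvPolynomial (Fin n) F[X]} (hD : map (Polynomial.constantCoeff : F[X] →+* F) D ≠ 0)
    (happrox : U * P * (map (algebraMap F (RatFunc F)) f₂ * map (algebraMap F[X] (RatFunc F)) D) =
      (map (algebraMap F (RatFunc F)) f₁ * map (algebraMap F[X] (RatFunc F)) D +
          C (algebraMap F[X] (RatFunc F) Polynomial.X) *
            (map (algebraMap F[X] (RatFunc F)) S * map (algebraMap F (RatFunc F)) f₂)) *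
        (V * Q)) :
    ∃ A B : MvPolynomial (Fin n) F,
      UABPComputes (((1 * (2 + d * ((n + 1) * 2 + 2)) + 2) + ((n + 1) * (t * ((n + 1) * e + 1)) + e + 2)) + 2) A ∧ UABPComputes ((1 * (2 + d * ((n + 1) * 2 + 2)) + 2) + ((n + 1) * (t * ((n + 1) * e + 1)) + e + 2)) B ∧
      B ≠ 0 ∧ f₁ * B = A * f₂ := by
  obtain ⟨U₀, V₀, P₀, Q₀, hU₀, hV₀, hP₀, hQ₀, hV₀0, hQ₀0, u, hu, -⟩ :=
    deborder_gen_one_ratio hU hV hP hQ hV0 hQ0 hf₂ hD happrox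
  refine ⟨C u * (U₀ * P₀), V₀ * Q₀, ?_, ?_, mul_ne_zero hV₀0 hQ₀0, by rw [hu]⟩
  · exact ((uabpComputes_of_mem_spsClass hU₀).mul (uabpComputes_of_mem_border_swsClass hP₀)).smul_C u
  · exact (uabpComputes_of_mem_spsClass hV₀).mul (uabpComputes_of_mem_border_swsClass hQ₀)

/-- **Claim 3.8's limit step in ABP currency** ("`(f_j/t)|_{z=0} ∈ lim_{ε→0}(Σ∧Σ/Σ∧Σ) ⊆
ARO/ARO`", p0036 L938–943): if a ratio `P/Q` of `Σ∧Σ` circuits over `F(ε)` equals an `ε`-integral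
fraction `M/E` (`E(0) ≠ 0`), its limit `M(0)/E(0)` is `u · A/B` with `A, B` computed by
univariate-labelled layered ABPs within the budget of Lemma 2.23 (`uabpComputes_of_mem_border_swsClass`)
and `B ≠ 0` — t19 g11's `border_div_swsClass` (`\overline{Σ∧Σ/Σ∧Σ} ⊆ \overline{Σ∧Σ}/\overline{Σ∧Σ}`)
followed by `\overline{Σ∧Σ} ⊆ ABP`; this is the currency of the trace-back's `z = 0` values
(brick B5, export (E_j.2)). [cite: DuttaDwivediSaxena2022, Claim 3.8 proof (full version p0036 L938–943) and Lemma 2.23 (p0025 L661–664)] -/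
theorem uabp_of_border_div_swsClass {t e : ℕ} {P Q : MvPolynomial (Fin n) (RatFunc F)}
    (hP : P ∈ swsClass (RatFunc F) n t e) (hQ : Q ∈ swsClass (RatFunc F) n t e) (hQ0 : Q ≠ 0)
    {E M : MvPolynomial (Fin n) F[X]} (hE : map (Polynomial.constantCoeff : F[X] →+* F) E ≠ 0)
    (heq : P * map (algebraMap F[X] (RatFunc F)) E = map (algebraMap F[X] (RatFunc F)) M * Q) :
    ∃ A B : MvPolynomial (Fin n) F,
      UABPComputes ((n + 1) * (t * ((n + 1) * e + 1)) + e + 2) A ∧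
      UABPComputes ((n + 1) * (t * ((n + 1) * e + 1)) + e + 2) B ∧ B ≠ 0 ∧
      ∃ u : F, map (Polynomial.constantCoeff : F[X] →+* F) M * B =
          C u * A * map (Polynomial.constantCoeff : F[X] →+* F) E ∧
        (map (Polynomial.constantCoeff : F[X] →+* F) M ≠ 0 → u ≠ 0) := by
  obtain ⟨P₀, Q₀, hP₀, hQ₀, hQ₀0, u, hu, hu0⟩ := border_div_swsClass hP hQ hQ0 hE heq
  exact ⟨P₀, Q₀, uabpComputes_of_mem_border_swsClass hP₀, uabpComputes_of_mem_border_swsClass hQ₀,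
    hQ₀0, u, hu, hu0⟩

end ClaimThreeThree

/-! ### §2 (v2) The `GenTerm`-packaged form -/

section GenTermPackaged

variable {F : Type*} [Field F] [CharZero F] {n d t e : ℕ}

/-- **Claim 3.3 for a `GenTerm` over `F(ε)`** (the data form of `uabp_of_deborder_gen_one`, now
that the data file `DDS21GenClass.lean` is in the tree): if the value `num T / den T` of a `Gen(1)`
term over `F(ε)` equals an `ε`-integral fraction `M/E` (`E(0) ≠ 0`) in cleared form
`num T · E = M · den T`, then its limit `M(0)/E(0)` is `u · A/B` with `A, B` computed by
univariate-labelled layered ABPs within the budget of Claim 3.3 and `B ≠ 0`.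
[cite: DuttaDwivediSaxena2022, Def. 3.1 and Claim 3.3 (full version p0026 L702–707, p0027 L724–744)] -/
theorem GenTerm.uabp_of_limit (T : GenTerm (RatFunc F) n d t e)
    {E M : MvPolynomial (Fin n) F[X]} (hE : map (Polynomial.constantCoeff : F[X] →+* F) E ≠ 0)
    (heq : T.num * map (algebraMap F[X] (RatFunc F)) E =
      map (algebraMap F[X] (RatFunc F)) M * T.den) :
    ∃ A B : MvPolynomial (Fin n) F,
      UABPComputes ((1 * (2 + d * ((n + 1) * 2 + 2)) + 2) + ((n + 1) * (t * ((n + 1) * e + 1)) + e + 2)) A ∧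
      UABPComputes ((1 * (2 + d * ((n + 1) * 2 + 2)) + 2) + ((n + 1) * (t * ((n + 1) * e + 1)) + e + 2)) B ∧
      B ≠ 0 ∧
      ∃ u : F, map (Polynomial.constantCoeff : F[X] →+* F) M * B =
          C u * A * map (Polynomial.constantCoeff : F[X] →+* F) E ∧
        (map (Polynomial.constantCoeff : F[X] →+* F) M ≠ 0 → u ≠ 0) :=
  uabp_of_deborder_gen_one T.U_mem T.V_mem T.P_mem T.Q_mem T.V_ne_zero T.Q_ne_zero hE heq

end GenTermPackaged

end DDS2021

end Literature.Computability.AlgebraicComplexity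

end
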